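import Summits.ValiantsHypothesis.ValiantsHypothesis.Theorems.LacunarySymmetroidMatrixDescartesCensusPivotGramExpansion
import Summits.ValiantsHypothesis.ValiantsHypothesis.Theorems.LacunarySymmetroidMatrixDescartesCensusPivotTwoDescartes

/-!
# `MatrixDescartes` (stmt-ValiantsHypothesis-18050) — pivot column: the RESOLVENT–DESCARTES BOUND at index 1 PROVED
# (`Pivot.RankOneResolventDescartes`: index `1 ⇒ Z₊ ≤ 2·C(K+m−1, m−1)`)

HONEST FRAMING.  Cell `pub-symmetroid`, seat `val-sym-mdr-p2` (gen 3); helper `--supports` the crux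
`Theses.LacunarySymmetroid.MatrixDescartes`, NO closure claim.  Proves the pivot column's row `RankOneResolventDescartes`
(`…CensusPivotDefs.lean`, conjb-1 g1, status there «CLAIMED provable … not kernel-proved») — a Descartes-scale bound for
THIN formats (better than the trivial ceiling `C(m+K, m) − 1` exactly when `K > m`); it says nothing at fat formats,
nothing about the crux in its window, `DoorA26`/`DoorA34`, or `VP ≠ VNP`.

THE THEOREM (`rankOneResolventDescartes_holds`).  `F = X^e J + ∑ₖ X^{dₖ} Pₖ` (`m × m`), `J` symmetric with
`J + W Wᵀ ⪰ 0` for some `W : m × 1` (pivot index `≤ 1`), all `Pₖ ⪰ 0` ⇒ `Z₊ ≤ 2·C(K+m−1, m−1)`.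
PROOF.  Factor `J + W Wᵀ = S₀S₀ᵀ`, `Pₖ = SₖSₖᵀ` (`CFC.sqrt`); then `F` is the signed Gram pencil of the `(K+1)·m + 1`
columns of `S₀, S₁, …, S_K` (weights `+X^{e}`, `+X^{dₖ}`) and `W` (weight `−X^{e}`), so by the Cauchy–Binet expansion
(`…PivotGramExpansion.det_gramPencil`) `det F = ∑_t ± det(C_t)² X^{deg t}` with sign `−` exactly for the `m`-subsets
`t` through the `W` column; a negative coefficient therefore sits at an exponent `e + (sum of m−1 letter exponents)`,
of which there are at most `#Sym(K+1 letters, m−1) = C(K+m−1, m−1)`; Descartes with a negative-support budget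
(`Pivot.TwoDescartes.card_posRoots_le_two_mul_card`) gives `Z₊ ≤ 2·C(K+m−1, m−1)`.  [folklore]
-/

-- layout Summits/ValiantsHypothesis/ValiantsHypothesis forces the duplicated namespace component
set_option linter.dupNamespace false

namespace Summit.ValiantsHypothesis.ValiantsHypothesis.Theorems.LacunarySymmetroidMatrixDescartes.Pivot

open Polynomial Matrix Finset
open scoped BigOperators MatrixOrder

namespace ResolventDescartes

/-- A real positive semidefinite matrix is a Gram matrix `S Sᵀ` (`S = √A`). [folklore] -/
theorem exists_eq_mul_transpose {m : Type} [Fintype m] [DecidableEq m] (A : Matrix m m ℝ) (hA : A.PosSemidef) :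
    ∃ S : Matrix m m ℝ, A = S * Sᵀ := by
  have h0 : 0 ≤ A := Matrix.nonneg_iff_posSemidef.2 hA
  have hS : CFC.sqrt A * CFC.sqrt A = A := CFC.sqrt_mul_sqrt_self A h0
  have ht : (CFC.sqrt A)ᵀ = CFC.sqrt A := by
    have h := (CFC.sqrt_nonneg A).isSelfAdjoint.star_eq
    rw [Matrix.star_eq_conjTranspose] at h
    simpa using h
  exact ⟨CFC.sqrt A, by rw [ht, hS]⟩

/-- `∑ c, (column c of S)(column c of S)ᵀ = S Sᵀ`, entrywise. [folklore] -/
theorem sum_col_mul_col {m : ℕ} (S : Matrix (Fin m) (Fin m) ℝ) (i i' : Fin m) :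
    ∑ c, S i c * S i' c = (S * Sᵀ) i i' := by
  simp [Matrix.mul_apply, Matrix.transpose_apply]

variable {m K : ℕ}

/-- The letters of the resolvent form: `none ↦` the positive part `S₀S₀ᵀ` of the pivot (exponent `e`), `some k ↦ Pₖ`.
Column pool `σ = (letters × columns) ⊕ {the pivot's negative column}`; its exponents and signs. -/
theorem pencil_eq_gram (e : ℕ) (d : Fin K → ℕ) (J : Matrix (Fin m) (Fin m) ℝ) (P : Fin K → Matrix (Fin m) (Fin m) ℝ)
    (W : Matrix (Fin m) (Fin 1) ℝ) (S₀ : Matrix (Fin m) (Fin m) ℝ) (S : Fin K → Matrix (Fin m) (Fin m) ℝ)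
    (hS₀ : J + W * Wᵀ = S₀ * S₀ᵀ) (hS : ∀ k, P k = S k * (S k)ᵀ)
    (ε : ((Option (Fin K) × Fin m) ⊕ Unit) ≃ Fin (Fintype.card ((Option (Fin K) × Fin m) ⊕ Unit))) :
    ((X : ℝ[X]) ^ e) • J.map Polynomial.C + ∑ k, ((X : ℝ[X]) ^ d k) • (P k).map Polynomial.C
      = ∑ j, (Polynomial.C ((Sum.elim (fun _ => (1 : ℝ)) (fun _ => -1)) (ε.symm j))
          * (X : ℝ[X]) ^ ((Sum.elim (fun oc => oc.1.elim e d) (fun _ => e)) (ε.symm j)))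
        • (Matrix.vecMulVec
            ((Sum.elim (fun oc => fun i => (oc.1.elim S₀ S) i oc.2) (fun _ => fun i => W i 0)) (ε.symm j))
            ((Sum.elim (fun oc => fun i => (oc.1.elim S₀ S) i oc.2) (fun _ => fun i => W i 0)) (ε.symm j))).map
          Polynomial.C := by
  refine Matrix.ext fun i i' => ?_
  -- left-hand entry
  have hL : (((X : ℝ[X]) ^ e) • J.map Polynomial.C + ∑ k, ((X : ℝ[X]) ^ d k) • (P k).map Polynomial.C) i i'
      = (X : ℝ[X]) ^ e * Polynomial.C (J i i') + ∑ k, (X : ℝ[X]) ^ d k * Polynomial.C (P k i i') := by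
    simp only [Matrix.add_apply, Matrix.smul_apply, Matrix.map_apply, Matrix.sum_apply, smul_eq_mul]
  -- right-hand entry, summed over `σ`
  have hR : (∑ j, (Polynomial.C ((Sum.elim (fun _ => (1 : ℝ)) (fun _ => -1)) (ε.symm j))
          * (X : ℝ[X]) ^ ((Sum.elim (fun oc => oc.1.elim e d) (fun _ => e)) (ε.symm j)))
        • (Matrix.vecMulVec
            ((Sum.elim (fun oc => fun i => (oc.1.elim S₀ S) i oc.2) (fun _ => fun i => W i 0)) (ε.symm j))
            ((Sum.elim (fun oc => fun i => (oc.1.elim S₀ S) i oc.2) (fun _ => fun i => W i 0)) (ε.symm j))).map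
          Polynomial.C) i i'
      = ∑ x : (Option (Fin K) × Fin m) ⊕ Unit,
          Polynomial.C ((Sum.elim (fun _ => (1 : ℝ)) (fun _ => -1)) x)
            * (X : ℝ[X]) ^ ((Sum.elim (fun oc => oc.1.elim e d) (fun _ => e)) x)
            * Polynomial.C (((Sum.elim (fun oc => fun i => (oc.1.elim S₀ S) i oc.2) (fun _ => fun i => W i 0)) x) i
              * ((Sum.elim (fun oc => fun i => (oc.1.elim S₀ S) i oc.2) (fun _ => fun i => W i 0)) x) i') := by
    rw [Matrix.sum_apply]
    simp only [Matrix.smul_apply, Matrix.map_apply, Matrix.vecMulVec_apply, smul_eq_mul]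
    exact Equiv.sum_comp ε.symm (fun x => Polynomial.C ((Sum.elim (fun _ => (1 : ℝ)) (fun _ => -1)) x)
      * (X : ℝ[X]) ^ ((Sum.elim (fun oc => oc.1.elim e d) (fun _ => e)) x)
      * Polynomial.C (((Sum.elim (fun oc => fun i => (oc.1.elim S₀ S) i oc.2) (fun _ => fun i => W i 0)) x) i
        * ((Sum.elim (fun oc => fun i => (oc.1.elim S₀ S) i oc.2) (fun _ => fun i => W i 0)) x) i'))
  rw [hL, hR, Fintype.sum_sum_type, Fintype.sum_prod_type, Fintype.sum_option]
  simp only [Sum.elim_inl, Sum.elim_inr, Option.elim_none, Option.elim_some, map_one, one_mul,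
    Finset.univ_unique, Finset.sum_singleton]
  -- the letter sums are the Gram matrices
  have h0 : ∑ c : Fin m, (X : ℝ[X]) ^ e * Polynomial.C (S₀ i c * S₀ i' c)
      = (X : ℝ[X]) ^ e * Polynomial.C ((J + W * Wᵀ) i i') := by
    rw [← Finset.mul_sum, ← map_sum, sum_col_mul_col, hS₀]
  have hk : ∀ k, ∑ c : Fin m, (X : ℝ[X]) ^ d k * Polynomial.C (S k i c * S k i' c)
      = (X : ℝ[X]) ^ d k * Polynomial.C (P k i i') := by
    intro k
    rw [← Finset.mul_sum, ← map_sum, sum_col_mul_col, ← hS k]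
  have hW : (W * Wᵀ) i i' = W i 0 * W i' 0 := by
    simp [Matrix.mul_apply, Matrix.transpose_apply]
  simp_rw [h0, hk]
  rw [Matrix.add_apply, hW, map_add, map_mul, map_neg, map_one]
  ring

/-- **`RankOneResolventDescartes` holds**: a pivot pencil of format `(m, K)` with pivot index `≤ 1` has at most
`2·C(K+m−1, m−1)` distinct positive determinant zeros. [folklore] -/
theorem pivotRootLawAt_one (m K : ℕ) : PivotRootLawAt m K 1 (2 * Nat.choose (K + m - 1) (m - 1)) := by
  classical
  intro e d J P hJ hP hW
  obtain ⟨W, hW⟩ := hW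
  obtain ⟨S₀, hS₀⟩ := exists_eq_mul_transpose (J + W * Wᵀ) hW
  choose S hS using fun k => exists_eq_mul_transpose (P k) (hP k)
  unfold pivotPosRoots
  set σ := (Option (Fin K) × Fin m) ⊕ Unit with hσ
  set ε : σ ≃ Fin (Fintype.card σ) := Fintype.equivFin σ with hε
  set sgσ : σ → ℝ := Sum.elim (fun _ => (1 : ℝ)) (fun _ => -1) with hsg
  set exσ : σ → ℕ := Sum.elim (fun oc => oc.1.elim e d) (fun _ => e) with hex
  set colσ : σ → Fin m → ℝ := Sum.elim (fun oc => fun i => (oc.1.elim S₀ S) i oc.2) (fun _ => fun i => W i 0)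
    with hcol
  rw [pencil_eq_gram e d J P W S₀ S hS₀ hS ε]
  -- the negative-support budget: exponents `e + (m − 1 letter exponents)`
  set Fs : Sym (Option (Fin K)) (m - 1) → ℕ :=
    fun s => e + ((s : Multiset (Option (Fin K))).map (fun o => o.elim e d)).sum with hFs
  have hTcard : (Finset.univ.image Fs).card ≤ Nat.choose (K + m - 1) (m - 1) := by
    calc (Finset.univ.image Fs).card ≤ (Finset.univ : Finset (Sym (Option (Fin K)) (m - 1))).card :=
          Finset.card_image_le
      _ = Nat.choose (K + 1 + (m - 1) - 1) (m - 1) := by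
          rw [Finset.card_univ, Sym.card_sym_eq_choose, Fintype.card_option, Fintype.card_fin]
      _ = Nat.choose (K + m - 1) (m - 1) := by
          rcases m with _ | m
          · simp
          · congr 1
            omega
  refine (TwoDescartes.card_posRoots_le_two_mul_card _ (Finset.univ.image Fs) fun n hn => ?_).trans
    (Nat.mul_le_mul_left 2 hTcard)
  -- a negative coefficient sits at `e + (m−1 letter exponents)`
  by_contra hnT
  refine absurd hn (not_lt.2 ?_)
  rw [GramExpansion.coeff_det_gramPencil]
  refine Finset.sum_nonneg fun t ht => ?_
  have htinj : Function.Injective t := (Finset.mem_filter.1 ht).2.injective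
  split_ifs with hsum
  · -- does the subset `t` use the negative column?
    by_cases hhit : ∃ a₀, ε.symm (t a₀) = Sum.inr ()
    · exfalso
      obtain ⟨a₀, ha₀⟩ := hhit
      have hm : 0 < m := Fin.pos a₀
      -- the other selected columns are letter columns
      have hother : ∀ a, a ≠ a₀ → ∃ oc : Option (Fin K) × Fin m, ε.symm (t a) = Sum.inl oc := by
        intro a ha
        rcases hx : ε.symm (t a) with oc | u
        · exact ⟨oc, rfl⟩
        · exfalso
          apply ha
          apply htinj
          apply ε.symm.injective
          rw [hx, ha₀]
      choose! oc hoc using hother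
      -- the multiset of their letters has `m − 1` elements and carries the exponent `n − e`
      set s : Multiset (Option (Fin K)) := (Finset.univ.erase a₀).val.map (fun a => (oc a).1) with hs
      have hscard : Multiset.card s = m - 1 := by
        rw [hs, Multiset.card_map, Finset.card_val, Finset.card_erase_of_mem (Finset.mem_univ a₀),
          Finset.card_univ, Fintype.card_fin]
      apply hnT
      refine Finset.mem_image.2 ⟨Sym.mk s hscard, Finset.mem_univ _, ?_⟩
      rw [hsum, ← Finset.add_sum_erase _ _ (Finset.mem_univ a₀)]
      have hsum' : (s.map fun o => o.elim e d).sum = ∑ a ∈ Finset.univ.erase a₀, exσ (ε.symm (t a)) := by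
        rw [hs, Multiset.map_map, Function.comp_def]
        rw [← Finset.sum_map_val]
        refine Finset.sum_congr rfl fun a ha => ?_
        rw [hoc a (Finset.ne_of_mem_erase ha), hex]
        simp only [Sum.elim_inl]
      change e + ((s.map fun o => o.elim e d).sum)
        = exσ (ε.symm (t a₀)) + ∑ a ∈ Finset.univ.erase a₀, exσ (ε.symm (t a))
      rw [hsum', ha₀, hex]
      simp only [Sum.elim_inr]
    · -- no negative column: the sign is `+1`
      push Not at hhit
      have hsg1 : ∏ a, sgσ (ε.symm (t a)) = 1 := by
        refine Finset.prod_eq_one fun a _ => ?_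
        rcases hx : ε.symm (t a) with oc | u
        · simp [hsg]
        · exact absurd hx (by cases u; exact hhit a)
      change 0 ≤ (∏ a, sgσ (ε.symm (t a))) * _
      rw [hsg1, one_mul]
      exact sq_nonneg _
  · exact le_rfl

end ResolventDescartes

/-- **The pivot column's row `RankOneResolventDescartes` (CLAIMED by conjb-1 g1) is PROVED.** [folklore] -/
theorem rankOneResolventDescartes_holds : RankOneResolventDescartes :=
  fun m K => ResolventDescartes.pivotRootLawAt_one m K

end Summit.ValiantsHypothesis.ValiantsHypothesis.Theorems.LacunarySymmetroidMatrixDescartes.Pivot
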